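import Literature.Topology.FourManifolds.RadialExtension
import Literature.Geometry.Riemannian.TwoConvexSchoenfliesProofs
import HarnessLib

/-!
# Unit families from smooth families of sphere maps (the input of the untwist zones)

Topic `Literature/Topology/FourManifolds`; companion of `TubeRadial.lean` (codimension `q = k + 1 ≥ 2`
steps of the smoothing of PD homeomorphisms: Munkres, Ann. of Math. 72 (1960), §§4–5;
Campbell–D'Onofrio–Vítek, J. Geom. Anal. (2026), Lemma 3.2 Step 4 / Lemma 3.4 Step 3; Cerf (1968),
Ch. I §1, Lemme 2).  The untwist zones of the tube stage use a **unit family**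
`Ψ : ℝ → E × ℝᵏ⁺¹ → ℝᵏ⁺¹` (hypotheses of `injective_fderiv_radialStageMap`: jointly `C^∞` off the
zero section, `‖Ψ‖ = 1`, degree-zero homogeneous in the fibre, nondegenerate angular
derivative).  Here we build such families from the natural manifold-level datum — a jointly
smooth family of sphere maps `G : ℝ → E × 𝕊ᵏ → 𝕊ᵏ` (e.g. the stages of a diffeotopy of `𝕊ᵏ`
composed with a reflection, or the links `θ ↦ N(x, r₁θ)/‖N(x, r₁θ)‖` of the normal part) — by

  `sphereFamily θ₀ G s (x, y) = G s (x, y/‖y‖)` (read in `ℝᵏ⁺¹`),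

and verify the four hypotheses: `contDiffAt_uncurry_sphereFamily` (joint smoothness off the zero
section, via `contMDiffAt_radialProjection` and `contMDiff_coe_sphere`), `norm_sphereFamily`,
`sphereFamily_smul` (homogeneity), and `sphereFamily_ker` — **if every partial map
`θ ↦ G s (x, θ)` has injective differential, the angular derivative of the family is
nondegenerate**: `D_y(sphereFamily)(w) = 0`, `w ⊥ y` force `w = 0` (chain rule through
`ι ∘ G_{s,x} ∘ π`, injectivity of `dι`, of `dG_{s,x}`, and `ker dπ(y) = ℝ y`).  Everything is
proved; the definition is an explicit function; no named facts.

## References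

* J. R. Munkres, *Obstructions to the smoothing of piecewise-differentiable homeomorphisms*, Ann.
  of Math. (2) 72 (1960), 521–554, §§4–5. [Munkres1960]
* D. Campbell, L. D'Onofrio, T. Vítek, *Diffeomorphic approximation of piecewise affine
  homeomorphisms*, J. Geom. Anal. 36 (2026), Lemma 3.2 (Step 4), Lemma 3.4 (Step 3).
  [CampbellDonofrioVitek2026]
* J. Cerf, *Sur les difféomorphismes de la sphère de dimension trois (Γ₄ = 0)*, LNM 53 (1968),
  Ch. I §1, Lemme 2. [CerfDiffeoSphere1968]
-/

noncomputable section

open Set Function Metric Module Filter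
open scoped Manifold ContDiff Topology RealInnerProductSpace

namespace Literature.Topology.FourManifolds

variable {k : ℕ} {E : Type*} [NormedAddCommGroup E] [NormedSpace ℝ E]

/-- **The unit family of a family of sphere maps**: `sphereFamily θ₀ G s (x, y) = G s (x, y/‖y‖)`
read in `ℝᵏ⁺¹` (junk direction `θ₀` at `y = 0`, never used). [folklore] -/
def sphereFamily (θ₀ : sphere (0 : EuclideanSpace ℝ (Fin (k + 1))) 1)
    (G : ℝ → E × sphere (0 : EuclideanSpace ℝ (Fin (k + 1))) 1 →
      sphere (0 : EuclideanSpace ℝ (Fin (k + 1))) 1)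
    (s : ℝ) (p : E × EuclideanSpace ℝ (Fin (k + 1))) : EuclideanSpace ℝ (Fin (k + 1)) :=
  (G s (p.1, radialProjection θ₀ p.2) : EuclideanSpace ℝ (Fin (k + 1)))

variable {θ₀ : sphere (0 : EuclideanSpace ℝ (Fin (k + 1))) 1}
  {G : ℝ → E × sphere (0 : EuclideanSpace ℝ (Fin (k + 1))) 1 →
    sphere (0 : EuclideanSpace ℝ (Fin (k + 1))) 1}

omit [NormedAddCommGroup E] [NormedSpace ℝ E] in
/-- **The family is a unit family.** [folklore] -/
@[simp]
theorem norm_sphereFamily (s : ℝ) (p : E × EuclideanSpace ℝ (Fin (k + 1))) :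
    ‖sphereFamily θ₀ G s p‖ = 1 := by
  rw [sphereFamily, norm_eq_of_mem_sphere]

omit [NormedAddCommGroup E] [NormedSpace ℝ E] in
/-- The family in terms of its stage and the radial projection. [folklore] -/
theorem sphereFamily_apply (s : ℝ) (p : E × EuclideanSpace ℝ (Fin (k + 1))) :
    sphereFamily θ₀ G s p = (G s (p.1, radialProjection θ₀ p.2) : EuclideanSpace ℝ (Fin (k + 1))) :=
  rfl

/-- The radial projection is homogeneous of degree zero: `π (c • y) = π y` for `c > 0`, `y ≠ 0`.
[folklore] -/
theorem radialProjection_smul_of_pos {y : EuclideanSpace ℝ (Fin (k + 1))} (hy : y ≠ 0) {c : ℝ}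
    (hc : 0 < c) : radialProjection θ₀ (c • y) = radialProjection θ₀ y := by
  have h := radialProjection_smul θ₀ (mul_pos hc (norm_pos_iff.2 hy)) (radialProjection θ₀ y)
  rw [← smul_smul, norm_smul_coe_radialProjection] at h
  exact h

omit [NormedAddCommGroup E] [NormedSpace ℝ E] in
/-- **The family is homogeneous of degree zero in the fibre.** [folklore] -/
theorem sphereFamily_smul (s : ℝ) {p : E × EuclideanSpace ℝ (Fin (k + 1))} (hp : p.2 ≠ 0) {c : ℝ}
    (hc : 0 < c) : sphereFamily θ₀ G s (p.1, c • p.2) = sphereFamily θ₀ G s p := by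
  rw [sphereFamily, sphereFamily, radialProjection_smul_of_pos hp hc]

omit [NormedAddCommGroup E] [NormedSpace ℝ E] in
/-- On unit vectors the family is the stage itself. [folklore] -/
theorem sphereFamily_coe_sphere (s : ℝ) (x : E) (θ : sphere (0 : EuclideanSpace ℝ (Fin (k + 1))) 1) :
    sphereFamily θ₀ G s (x, (θ : EuclideanSpace ℝ (Fin (k + 1)))) =
      (G s (x, θ) : EuclideanSpace ℝ (Fin (k + 1))) := by
  rw [sphereFamily, radialProjection_coe_sphere]

/-- **Joint smoothness off the zero section.** If `uncurry G : ℝ × (E × 𝕊ᵏ) → 𝕊ᵏ` is `C^∞`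
(manifold sense) then `uncurry (sphereFamily θ₀ G)` is `C^∞` at every `(s, (x, y))` with `y ≠ 0`.
[folklore] -/
theorem contDiffAt_uncurry_sphereFamily
    (hG : ContMDiff (𝓘(ℝ, ℝ).prod (𝓘(ℝ, E).prod (𝓡 k))) (𝓡 k) ∞ (uncurry G))
    {s : ℝ} {p : E × EuclideanSpace ℝ (Fin (k + 1))} (hp : p.2 ≠ 0) :
    ContDiffAt ℝ ∞ (uncurry (sphereFamily θ₀ G)) (s, p) := by
  haveI : Fact (finrank ℝ (EuclideanSpace ℝ (Fin (k + 1))) = k + 1) := ⟨finrank_euclideanSpace_fin⟩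
  -- the inner map `(s, (x, y)) ↦ (s, (x, π y))`
  have hπ : ContMDiffAt 𝓘(ℝ, ℝ × (E × EuclideanSpace ℝ (Fin (k + 1)))) (𝓡 k) ∞
      (fun q : ℝ × (E × EuclideanSpace ℝ (Fin (k + 1))) => radialProjection θ₀ q.2.2) (s, p) :=
    (contMDiffAt_radialProjection θ₀ hp).comp (s, p)
      (contDiffAt_snd.comp (s, p) contDiffAt_snd).contMDiffAt
  have h1 : ContMDiffAt 𝓘(ℝ, ℝ × (E × EuclideanSpace ℝ (Fin (k + 1))))
      (𝓘(ℝ, ℝ).prod (𝓘(ℝ, E).prod (𝓡 k))) ∞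
      (fun q : ℝ × (E × EuclideanSpace ℝ (Fin (k + 1))) => (q.1, (q.2.1, radialProjection θ₀ q.2.2)))
      (s, p) :=
    contDiffAt_fst.contMDiffAt.prodMk
      ((contDiffAt_fst.comp (s, p) contDiffAt_snd).contMDiffAt.prodMk hπ)
  have h2 : ContMDiffAt 𝓘(ℝ, ℝ × (E × EuclideanSpace ℝ (Fin (k + 1)))) (𝓡 k) ∞
      (fun q : ℝ × (E × EuclideanSpace ℝ (Fin (k + 1))) => G q.1 (q.2.1, radialProjection θ₀ q.2.2))
      (s, p) :=
    hG.contMDiffAt.comp (s, p) h1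
  have h3 : ContMDiffAt 𝓘(ℝ, ℝ × (E × EuclideanSpace ℝ (Fin (k + 1))))
      𝓘(ℝ, EuclideanSpace ℝ (Fin (k + 1))) ∞
      (fun q : ℝ × (E × EuclideanSpace ℝ (Fin (k + 1))) =>
        ((G q.1 (q.2.1, radialProjection θ₀ q.2.2) : sphere (0 : EuclideanSpace ℝ (Fin (k + 1))) 1) :
          EuclideanSpace ℝ (Fin (k + 1)))) (s, p) :=
    contMDiff_coe_sphere.contMDiffAt.comp (s, p) h2
  exact contMDiffAt_iff_contDiffAt.1 h3

/-- The stage maps `θ ↦ G s (x, θ)` of a jointly smooth family are smooth. [folklore] -/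
theorem contMDiff_sphereFamily_stage
    (hG : ContMDiff (𝓘(ℝ, ℝ).prod (𝓘(ℝ, E).prod (𝓡 k))) (𝓡 k) ∞ (uncurry G)) (s : ℝ) (x : E) :
    ContMDiff (𝓡 k) (𝓡 k) ∞ (fun θ => G s (x, θ)) := by
  have h1 : ContMDiff (𝓡 k) (𝓘(ℝ, ℝ).prod (𝓘(ℝ, E).prod (𝓡 k))) ∞
      (fun θ : sphere (0 : EuclideanSpace ℝ (Fin (k + 1))) 1 => ((s, (x, θ)) : ℝ × (E × _))) :=
    contMDiff_const.prodMk (contMDiff_const.prodMk contMDiff_id)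
  exact hG.comp h1

/-- **Nondegeneracy of the angular derivative.** If `uncurry G` is `C^∞` and the stage
`θ ↦ G s (x, θ)` has injective differential at `π y` (`y ≠ 0`), then the fibre derivative of the
unit family kills no nonzero vector orthogonal to `y`:
`D(y' ↦ sphereFamily θ₀ G s (x, y'))(y) w = 0`, `⟪y, w⟫ = 0 ⟹ w = 0`. [folklore] -/
theorem sphereFamily_ker_fibre
    (hG : ContMDiff (𝓘(ℝ, ℝ).prod (𝓘(ℝ, E).prod (𝓡 k))) (𝓡 k) ∞ (uncurry G))
    {s : ℝ} {x : E} {y : EuclideanSpace ℝ (Fin (k + 1))} (hy : y ≠ 0)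
    (hinj : Injective (mfderiv (𝓡 k) (𝓡 k) (fun θ => G s (x, θ)) (radialProjection θ₀ y)))
    {w : EuclideanSpace ℝ (Fin (k + 1))} (hw : ⟪y, w⟫ = 0)
    (h0 : fderiv ℝ (fun y' => sphereFamily θ₀ G s (x, y')) y w = 0) : w = 0 := by
  haveI : Fact (finrank ℝ (EuclideanSpace ℝ (Fin (k + 1))) = k + 1) := ⟨finrank_euclideanSpace_fin⟩
  set g : sphere (0 : EuclideanSpace ℝ (Fin (k + 1))) 1 → sphere (0 : EuclideanSpace ℝ (Fin (k + 1))) 1 :=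
    fun θ => G s (x, θ) with hg
  have hgs : ContMDiff (𝓡 k) (𝓡 k) ∞ g := contMDiff_sphereFamily_stage hG s x
  -- the fibre map is `ι ∘ g ∘ π`
  have hfun : (fun y' => sphereFamily θ₀ G s (x, y')) =
      (Subtype.val ∘ g) ∘ radialProjection θ₀ := rfl
  have hπd : MDifferentiableAt 𝓘(ℝ, EuclideanSpace ℝ (Fin (k + 1))) (𝓡 k) (radialProjection θ₀) y :=
    (contMDiffAt_radialProjection θ₀ hy).mdifferentiableAt (by simp)
  have hιg : MDifferentiableAt (𝓡 k) 𝓘(ℝ, EuclideanSpace ℝ (Fin (k + 1))) (Subtype.val ∘ g)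
      (radialProjection θ₀ y) :=
    ((contMDiff_coe_sphere.comp hgs).mdifferentiableAt (by simp))
  have hchain : fderiv ℝ (fun y' => sphereFamily θ₀ G s (x, y')) y =
      (mfderiv (𝓡 k) 𝓘(ℝ, EuclideanSpace ℝ (Fin (k + 1))) (Subtype.val ∘ g) (radialProjection θ₀ y)).comp
        (mfderiv 𝓘(ℝ, EuclideanSpace ℝ (Fin (k + 1))) (𝓡 k) (radialProjection θ₀) y) := by
    rw [← mfderiv_eq_fderiv, hfun]
    exact mfderiv_comp y hιg hπd
  have hchain2 : mfderiv (𝓡 k) 𝓘(ℝ, EuclideanSpace ℝ (Fin (k + 1))) (Subtype.val ∘ g)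
      (radialProjection θ₀ y) =
      (mfderiv (𝓡 k) 𝓘(ℝ, EuclideanSpace ℝ (Fin (k + 1))) Subtype.val (g (radialProjection θ₀ y))).comp
        (mfderiv (𝓡 k) (𝓡 k) g (radialProjection θ₀ y)) :=
    mfderiv_comp _ ((contMDiff_coe_sphere (m := ∞) (n := k)).mdifferentiableAt (by simp))
      (hgs.mdifferentiableAt (by simp))
  -- so `dπ(y) w = 0`
  have hπw : mfderiv 𝓘(ℝ, EuclideanSpace ℝ (Fin (k + 1))) (𝓡 k) (radialProjection θ₀) y w = 0 := by
    rw [hchain, hchain2] at h0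
    have h0' : (mfderiv (𝓡 k) 𝓘(ℝ, EuclideanSpace ℝ (Fin (k + 1))) Subtype.val (g (radialProjection θ₀ y)))
        ((mfderiv (𝓡 k) (𝓡 k) g (radialProjection θ₀ y))
          ((mfderiv 𝓘(ℝ, EuclideanSpace ℝ (Fin (k + 1))) (𝓡 k) (radialProjection θ₀) y) w)) = 0 := h0
    have h1 := (injective_iff_map_eq_zero _).1 (mfderiv_coe_sphere_injective (n := k) _) _ h0'
    exact (injective_iff_map_eq_zero _).1 hinj _ h1
  -- and `D(ι ∘ π)(y) w = 0`, where `ι ∘ π = (z ↦ z/‖z‖)` near `y`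
  have hιπ : fderiv ℝ (fun z : EuclideanSpace ℝ (Fin (k + 1)) => ‖z‖⁻¹ • z) y w = 0 := by
    have hev : (fun z : EuclideanSpace ℝ (Fin (k + 1)) => ‖z‖⁻¹ • z) =ᶠ[𝓝 y]
        (Subtype.val ∘ radialProjection θ₀) := by
      filter_upwards [isOpen_ne.mem_nhds hy] with z hz
      exact (coe_radialProjection_of_ne_zero θ₀ hz).symm
    rw [hev.fderiv_eq, ← mfderiv_eq_fderiv,
      mfderiv_comp y ((contMDiff_coe_sphere (m := ∞) (n := k)).mdifferentiableAt (by simp)) hπd]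
    change (mfderiv (𝓡 k) 𝓘(ℝ, EuclideanSpace ℝ (Fin (k + 1))) Subtype.val (radialProjection θ₀ y))
        ((mfderiv 𝓘(ℝ, EuclideanSpace ℝ (Fin (k + 1))) (𝓡 k) (radialProjection θ₀) y) w) = 0
    rw [hπw, map_zero]
  obtain ⟨c, hc⟩ := Literature.Geometry.Riemannian.exists_eq_smul_of_fderiv_inv_norm_smul_eq_zero hy hιπ
  rw [hc, inner_smul_right, real_inner_self_eq_norm_sq] at hw
  have hc0 : c = 0 := by
    rcases mul_eq_zero.1 hw with h | h
    · exact h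
    · exact absurd (pow_eq_zero_iff two_ne_zero |>.1 h) (norm_ne_zero_iff.2 hy)
  rw [hc, hc0, zero_smul]

/-- **The `hker` hypothesis of `injective_fderiv_radialStageMap`** for unit families built from
sphere families: with `uncurry G` smooth and the stage `θ ↦ G (λ ‖y‖) (x, θ)` having injective
differential at `π y`, every `w ⊥ y` with `D(uncurry Ψ)(λ ‖y‖, (x, y)) (0, (0, w)) = 0` vanishes.
[folklore] -/
theorem sphereFamily_ker
    (hG : ContMDiff (𝓘(ℝ, ℝ).prod (𝓘(ℝ, E).prod (𝓡 k))) (𝓡 k) ∞ (uncurry G))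
    {s : ℝ} {p : E × EuclideanSpace ℝ (Fin (k + 1))} (hp : p.2 ≠ 0)
    (hinj : Injective (mfderiv (𝓡 k) (𝓡 k) (fun θ => G s (p.1, θ)) (radialProjection θ₀ p.2)))
    (w : EuclideanSpace ℝ (Fin (k + 1))) (hw : ⟪p.2, w⟫ = 0)
    (h0 : fderiv ℝ (uncurry (sphereFamily θ₀ G)) (s, p) (0, ((0 : E), w)) = 0) : w = 0 := by
  -- the fibre map is `uncurry Ψ ∘ (y' ↦ (s, (x, y')))`
  have hd : DifferentiableAt ℝ (uncurry (sphereFamily θ₀ G)) (s, p) :=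
    (contDiffAt_uncurry_sphereFamily hG hp).differentiableAt (by simp)
  have hι : HasFDerivAt
      (fun y' : EuclideanSpace ℝ (Fin (k + 1)) => ((s, (p.1, y')) : ℝ × (E × EuclideanSpace ℝ (Fin (k + 1)))))
      ((0 : EuclideanSpace ℝ (Fin (k + 1)) →L[ℝ] ℝ).prod
        ((0 : EuclideanSpace ℝ (Fin (k + 1)) →L[ℝ] E).prod
          (ContinuousLinearMap.id ℝ (EuclideanSpace ℝ (Fin (k + 1)))))) p.2 :=
    (hasFDerivAt_const s p.2).prodMk ((hasFDerivAt_const p.1 p.2).prodMk (hasFDerivAt_id p.2))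
  have hcomp := hd.hasFDerivAt.comp p.2 hι
  have hfd : fderiv ℝ (fun y' => sphereFamily θ₀ G s (p.1, y')) p.2 w =
      fderiv ℝ (uncurry (sphereFamily θ₀ G)) (s, p) (0, ((0 : E), w)) := by
    have hfun : (fun y' => sphereFamily θ₀ G s (p.1, y')) =
        uncurry (sphereFamily θ₀ G) ∘
          (fun y' : EuclideanSpace ℝ (Fin (k + 1)) =>
            ((s, (p.1, y')) : ℝ × (E × EuclideanSpace ℝ (Fin (k + 1))))) := rfl
    rw [hfun, hcomp.fderiv]
    rfl
  exact sphereFamily_ker_fibre hG hp hinj hw (by rw [hfd]; exact h0)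

end Literature.Topology.FourManifolds
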